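import Literature.AlgebraicGeometry.Milne1999.SpecialLefschetzGroupOneEqUnitaryCentralizer
import Literature.AlgebraicGeometry.HodgeTheory.MumfordTateGroupExteriorAction
import HarnessLib

/-!
# Milne 1999, Theorem 4.4 read on `H¹` for the full Lefschetz group: `{g₁ | g ∈ L(A)(ℂ)} = G(A)(ℂ) = ℂˣ · S(A)(ℂ)`

Milne [Milne1999LefschetzClasses, §4 p. 659, Thm. 4.4]: «Let `G(A)` be the algebraic subgroup of `GL(V(A))` such
that `G(A)(R) = {γ ∈ C(A) ⊗ R | γ†γ ∈ R^×}` … **Theorem 4.4.** The map `γ ↦ (γ, γ†γ)` identifies `G(A)` with `L(A)`»;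
p. 659: «the homomorphism `a ↦ (a⁻¹, a⁻²) : 𝔾_m → GL(V(A)) × 𝔾_m` takes values in `L(A)`. Therefore `L(A)` has a
canonical cocharacter `w` … `l ∘ w = -2` … the kernel of `l(A)`, regarded as a subgroup of `GL(V(A))`, equals
`S(A)`».

The tree PROVED Thm. 4.4 for the kernel `S(A) = ker l(A)` on `H¹`
(`Milne1999_thm44_specialLefschetzGroup_one_eq_unitaryCentralizerGroup_holds`:
`{g₁ | g ∈ specialLefschetzGroup} = unitaryCentralizerGroup A h`) and the decomposition `L = w(ℂˣ) · ker l`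
(`mem_lefschetzGroup_iff_exists_weightCocharacter_mul`). This file (all `theorem`s, no definition, no named fact)
assembles the statement for `L(A)` itself:
* **`G(A)(ℂ) = ℂˣ · S(A)(ℂ)`** (`mem_similitudeCentralizerGroup_iff_exists_smulOfUnit_mul`): an automorphism of
  `H¹(A(ℂ); ℂ)` commuting with `End(A)` and multiplying `Q_h` by a unit `μ` is `c · u'` with `c² = μ` and `u'`
  preserving `Q_h` (`ℂ` has square roots);
* **`{g₁ | g ∈ L(A)(ℂ)} = G(A)(ℂ)`** for a polarization class `h` (rational, `s · h` Kähler, `s > 0`)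
  (`lefschetzGroup_map_one_eq_similitudeCentralizerGroup`), `= ℂˣ · S(A)(ℂ)` (`mem_map_lefschetzGroup_one_iff`); hence
  `G(A)(ℂ)` does not depend on the polarization, `S(A)(ℂ) ≤ L(A)(ℂ)|_{H¹}`, the scalars lie in `L(A)(ℂ)|_{H¹}`, and
  `MT(A)(ℂ)|_{H¹} ≤ L(A)(ℂ)|_{H¹}`, `MT(A)(ℂ)|_{H¹} ≤ G(A)(ℂ)` («`L(A) ⊃ Hg(A)`», p. 660).

## References

* [Milne1999LefschetzClasses] J. S. Milne, *Lefschetz classes on abelian varieties*, Duke Math. J. 96 (1999), §1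
  pp. 642–644, §4 p. 659 (G(A), w, l), Thm. 4.4, p. 660.
* [Milne1999] J. S. Milne, *Lefschetz motives and the Tate conjecture*, Compositio Math. 117 (1999), §1 p. 52
  (`L(A)(R) = {(γ, c) | γ†γ = c}`).
-/

noncomputable section

open CategoryTheory
open Literature.AlgebraicTopology.SingularHomology
open Literature.AlgebraicGeometry.HodgeTheory
open Literature.AlgebraicGeometry.Motives
open Literature.AlgebraicGeometry.VanGeemen1994 (pullbackOne hodgeGroupOne mem_hodgeGroupOne_iff hodgeClassSpan)

namespace Literature.AlgebraicGeometry.Milne1999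

variable {A : AbelianVariety ℂ} {h h' : complexBetti A.X 2} {u : complexBetti A.X 1 ≃ₗ[ℂ] complexBetti A.X 1}

/-- The scalar automorphism `c · id`, evaluated. [folklore] -/
private theorem smulOfUnit_apply'' (c : ℂˣ) (x : complexBetti A.X 1) :
    LinearEquiv.smulOfUnit c x = (c : ℂ) • x := by
  simp [LinearEquiv.smulOfUnit, Units.smul_def]

/-- `(c · id) * (c⁻¹ · id) = id`. [folklore] -/
private theorem smulOfUnit_mul_smulOfUnit_inv (c : ℂˣ) :
    (LinearEquiv.smulOfUnit c * LinearEquiv.smulOfUnit c⁻¹ :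
      complexBetti A.X 1 ≃ₗ[ℂ] complexBetti A.X 1) = 1 := by
  refine LinearEquiv.ext fun x ↦ ?_
  rw [LinearEquiv.mul_apply, smulOfUnit_apply'', smulOfUnit_apply'', smul_smul, Units.mul_inv, one_smul]
  rfl

/-! ### §1 `G(A)(ℂ) = ℂˣ · S(A)(ℂ)` -/

/-- **`G(A)(ℂ) = ℂˣ · S(A)(ℂ)`**: an automorphism `u` of `H¹(A(ℂ); ℂ)` commuting with `End(A)` and multiplying `Q_h` by
a unit `μ` (Milne's `G(A)(ℂ)`, the tree's `similitudeCentralizerGroup A h`) is `c · u'` with `c ∈ ℂˣ` (`c² = μ`) and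
`u' ∈ S(A)(ℂ)` (`unitaryCentralizerGroup A h`), and conversely — on `ℂ`-points `G(A) = w(𝔾_m) · ker l(A)` with
`l ∘ w = -2`. [cite: Milne1999LefschetzClasses, §4 p. 659 (G(A), the cocharacters w and l, ker l = S(A))] -/
theorem mem_similitudeCentralizerGroup_iff_exists_smulOfUnit_mul :
    u ∈ similitudeCentralizerGroup A h ↔
      ∃ c : ℂˣ, ∃ u' ∈ unitaryCentralizerGroup A h, u = LinearEquiv.smulOfUnit c * u' := by
  constructor
  · rintro ⟨hc, μ, hμ⟩
    obtain ⟨s, hs⟩ := IsAlgClosed.exists_pow_nat_eq (μ : ℂ) two_pos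
    have hs0 : s ≠ 0 := by
      rintro rfl
      rw [zero_pow two_ne_zero] at hs
      exact μ.ne_zero hs.symm
    refine ⟨Units.mk0 s hs0, LinearEquiv.smulOfUnit (Units.mk0 s hs0)⁻¹ * u, ⟨?_, fun x y ↦ ?_⟩, ?_⟩
    · exact (centralizerGroup A).mul_mem (smulOfUnit_mem_similitudeCentralizerGroup A h _).1 hc
    · rw [LinearEquiv.mul_apply, LinearEquiv.mul_apply, smulOfUnit_apply'', smulOfUnit_apply'', map_smul, map_smul,
        LinearMap.smul_apply, smul_smul, hμ x y, smul_smul]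
      have key : (((Units.mk0 s hs0)⁻¹ : ℂˣ) : ℂ) * (((Units.mk0 s hs0)⁻¹ : ℂˣ) : ℂ) * (μ : ℂ) = 1 := by
        rw [Units.val_inv_eq_inv_val, Units.val_mk0, ← hs]
        field_simp
      rw [key, one_smul]
    · rw [← mul_assoc, smulOfUnit_mul_smulOfUnit_inv, one_mul]
  · rintro ⟨c, u', hu', rfl⟩
    exact (similitudeCentralizerGroup A h).mul_mem (smulOfUnit_mem_similitudeCentralizerGroup A h c)
      (unitaryCentralizerGroup_le_similitudeCentralizerGroup hu')

/-! ### §2 Theorem 4.4 on `H¹` for `L(A)`: `{g₁ | g ∈ L(A)(ℂ)} = G(A)(ℂ)` -/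

/-- **Milne 1999, Theorem 4.4 on `H¹` for the Lefschetz group itself: `{g₁ | g ∈ L(A)(ℂ)} = G(A)(ℂ)`** for a
polarization class `h` (rational, `s · h` Kähler for a real `s > 0`): the degree-one components of the Künneth
families acting on the Lefschetz classes of all powers through a Tate character (the tree's `lefschetzGroup`) are
exactly the automorphisms of `H¹(A(ℂ); ℂ)` commuting with `End(A)` and multiplying `Q_h` by a unit
(`L = w(ℂˣ) · ker l`, `mem_lefschetzGroup_iff_exists_weightCocharacter_mul`; `{g₁ | g ∈ ker l} = S(A)(ℂ)`, the PROVED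
record `Milne1999_thm44_specialLefschetzGroup_one_eq_unitaryCentralizerGroup_holds`; `G = ℂˣ · S`).
[cite: Milne1999LefschetzClasses, Thm. 4.4 and p. 659] [cite: Milne1999, §1 p. 52] -/
theorem lefschetzGroup_map_one_eq_similitudeCentralizerGroup (hQ : IsRationalClass h)
    (hK : ∃ s : ℝ, 0 < s ∧ IsKaehlerClass A.dim A.X ((s : ℂ) • h)) :
    (lefschetzGroup A.dim A.X).map
        (Pi.evalMonoidHom (fun k : ℕ ↦ complexBetti A.X k ≃ₗ[ℂ] complexBetti A.X k) 1) =
      similitudeCentralizerGroup A h := by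
  ext u
  rw [mem_similitudeCentralizerGroup_iff_exists_smulOfUnit_mul]
  constructor
  · rintro ⟨g, hg, rfl⟩
    obtain ⟨c, g', hg', rfl⟩ := mem_lefschetzGroup_iff_exists_weightCocharacter_mul.1 hg
    exact ⟨c, g' 1, apply_one_mem_unitaryCentralizerGroup_of_thm44
      Milne1999_thm44_specialLefschetzGroup_one_eq_unitaryCentralizerGroup_holds hQ hK hg',
      weightCocharacter_mul_apply_one c g'⟩
  · rintro ⟨c, u', hu', rfl⟩
    obtain ⟨g', hg', hg'u⟩ := exists_mem_specialLefschetzGroup_of_thm44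
      Milne1999_thm44_specialLefschetzGroup_one_eq_unitaryCentralizerGroup_holds hQ hK hu'
    refine ⟨weightCocharacter A.X c * g', (lefschetzGroup A.dim A.X).mul_mem (weightCocharacter_mem_lefschetzGroup c)
      (specialLefschetzGroup_le_lefschetzGroup hg'), ?_⟩
    rw [← hg'u]
    exact weightCocharacter_mul_apply_one c g'

/-- **`{g₁ | g ∈ L(A)(ℂ)} = ℂˣ · S(A)(ℂ)`** for a polarization class `h`: `u` is the degree-one component of an element
of the Lefschetz group iff `u = c · u'` with `c ∈ ℂˣ`, `u' ∈ S(A)(ℂ)`. [cite: Milne1999LefschetzClasses, Thm. 4.4 and p. 659] -/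
theorem mem_map_lefschetzGroup_one_iff (hQ : IsRationalClass h) (hK : ∃ s : ℝ, 0 < s ∧ IsKaehlerClass A.dim A.X ((s : ℂ) • h)) :
    u ∈ (lefschetzGroup A.dim A.X).map
        (Pi.evalMonoidHom (fun k : ℕ ↦ complexBetti A.X k ≃ₗ[ℂ] complexBetti A.X k) 1) ↔
      ∃ c : ℂˣ, ∃ u' ∈ unitaryCentralizerGroup A h, u = LinearEquiv.smulOfUnit c * u' := by
  rw [lefschetzGroup_map_one_eq_similitudeCentralizerGroup hQ hK, mem_similitudeCentralizerGroup_iff_exists_smulOfUnit_mul]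

/-- **`G(A)(ℂ)` does not depend on the polarization** («for any ample divisor `D` on `A`, `G(A)` is the largest
algebraic subgroup of `GSp(E^D)` commuting with the endomorphisms of `A`», p. 659), unconditionally in the record:
two polarization classes give the same subgroup of `GL(H¹(A(ℂ); ℂ))`. [cite: Milne1999LefschetzClasses, §4 p. 659 and §1 p. 643] -/
theorem similitudeCentralizerGroup_eq_of_isKaehlerClass (hQ : IsRationalClass h)
    (hK : ∃ s : ℝ, 0 < s ∧ IsKaehlerClass A.dim A.X ((s : ℂ) • h)) (hQ' : IsRationalClass h')
    (hK' : ∃ s : ℝ, 0 < s ∧ IsKaehlerClass A.dim A.X ((s : ℂ) • h')) :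
    similitudeCentralizerGroup A h = similitudeCentralizerGroup A h' := by
  rw [← lefschetzGroup_map_one_eq_similitudeCentralizerGroup hQ hK,
    lefschetzGroup_map_one_eq_similitudeCentralizerGroup hQ' hK']

/-- **`S(A)(ℂ) ≤ {g₁ | g ∈ L(A)(ℂ)}`** for a polarization class `h` (`ker l ≤ L`). [cite: Milne1999LefschetzClasses, Thm. 4.4 and p. 659] -/
theorem unitaryCentralizerGroup_le_lefschetzGroup_map_one (hQ : IsRationalClass h)
    (hK : ∃ s : ℝ, 0 < s ∧ IsKaehlerClass A.dim A.X ((s : ℂ) • h)) :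
    unitaryCentralizerGroup A h ≤ (lefschetzGroup A.dim A.X).map
      (Pi.evalMonoidHom (fun k : ℕ ↦ complexBetti A.X k ≃ₗ[ℂ] complexBetti A.X k) 1) :=
  (unitaryCentralizerGroup_le_specialLefschetzGroup_map_one hQ hK).trans
    (Subgroup.map_mono specialLefschetzGroup_le_lefschetzGroup)

/-- `G(A)(ℂ) ≤ {g₁ | g ∈ L(A)(ℂ)}` — the `⊇` half of Thm. 4.4 for `L(A)` on `H¹`. [cite: Milne1999LefschetzClasses, Thm. 4.4 (proof, first half)] -/
theorem similitudeCentralizerGroup_le_lefschetzGroup_map_one (hQ : IsRationalClass h)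
    (hK : ∃ s : ℝ, 0 < s ∧ IsKaehlerClass A.dim A.X ((s : ℂ) • h)) :
    similitudeCentralizerGroup A h ≤ (lefschetzGroup A.dim A.X).map
      (Pi.evalMonoidHom (fun k : ℕ ↦ complexBetti A.X k ≃ₗ[ℂ] complexBetti A.X k) 1) :=
  (lefschetzGroup_map_one_eq_similitudeCentralizerGroup hQ hK).symm.le

variable (A) in
/-- `{g₁ | g ∈ L(A)(ℂ)} ≤ G(A)(ℂ)` — the `⊆` half of Thm. 4.4 for `L(A)` on `H¹` (holds for every class `h` rational with a
Kähler multiple; the divisor classes of degree `2` on `A × A` force `g₁` into `C(A)` and to scale `Q_h`).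
[cite: Milne1999LefschetzClasses, Thm. 4.4 (proof, second half) and p. 659] -/
theorem lefschetzGroup_map_one_le_similitudeCentralizerGroup (hQ : IsRationalClass h)
    (hK : ∃ s : ℝ, 0 < s ∧ IsKaehlerClass A.dim A.X ((s : ℂ) • h)) :
    (lefschetzGroup A.dim A.X).map
        (Pi.evalMonoidHom (fun k : ℕ ↦ complexBetti A.X k ≃ₗ[ℂ] complexBetti A.X k) 1) ≤
      similitudeCentralizerGroup A h :=
  (lefschetzGroup_map_one_eq_similitudeCentralizerGroup hQ hK).le

/-- **The scalars lie in `{g₁ | g ∈ L(A)(ℂ)}`** (the weight cocharacter `w(𝔾_m) ≤ L(A)`, p. 659).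
[cite: Milne1999LefschetzClasses, §4 p. 659 (the cocharacter w)] -/
theorem smulOfUnit_mem_lefschetzGroup_map_one (c : ℂˣ) :
    LinearEquiv.smulOfUnit c ∈ (lefschetzGroup A.dim A.X).map
      (Pi.evalMonoidHom (fun k : ℕ ↦ complexBetti A.X k ≃ₗ[ℂ] complexBetti A.X k) 1) := by
  refine ⟨weightCocharacter A.X c, weightCocharacter_mem_lefschetzGroup c, ?_⟩
  have e := weightCocharacter_mul_apply_one c (1 : ∀ k : ℕ, complexBetti A.X k ≃ₗ[ℂ] complexBetti A.X k)
  rw [mul_one] at e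
  rw [Pi.evalMonoidHom_apply, e]
  exact mul_one _

/-! ### §3 «`L(A) ⊃ Hg(A)`» on `H¹` -/

/-- **`MT(A)(ℂ)|_{H¹} ≤ L(A)(ℂ)|_{H¹}`** («`L(A) ⊃ Hg(A)`», p. 660, in Milne's `GL × 𝔾_m` convention: the tree's
`mumfordTateGroup ≤ lefschetzGroup`, `AbelianVariety.hodgeGroup_le_specialLefschetzGroup`), read in degree one.
[cite: Milne1999LefschetzClasses, §4 p. 660] -/
theorem mumfordTateGroup_map_one_le_lefschetzGroup_map_one :
    (mumfordTateGroup A.dim A.X).map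
        (Pi.evalMonoidHom (fun k : ℕ ↦ complexBetti A.X k ≃ₗ[ℂ] complexBetti A.X k) 1) ≤
      (lefschetzGroup A.dim A.X).map
        (Pi.evalMonoidHom (fun k : ℕ ↦ complexBetti A.X k ≃ₗ[ℂ] complexBetti A.X k) 1) :=
  Subgroup.map_mono (AbelianVariety.hodgeGroup_le_specialLefschetzGroup A).2

/-- **`Hg′(A)(ℂ)|_{H¹} ≤ {g₁ | g ∈ ker l(A)(ℂ)}`** («`L(A) ⊃ Hg(A)`» for the kernels), read in degree one.
[cite: Milne1999LefschetzClasses, §4 p. 660] -/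
theorem hodgeGroupOne_le_specialLefschetzGroup_map_one :
    hodgeGroupOne A.dim A.X ≤ (specialLefschetzGroup A.dim A.X).map
      (Pi.evalMonoidHom (fun k : ℕ ↦ complexBetti A.X k ≃ₗ[ℂ] complexBetti A.X k) 1) :=
  Subgroup.map_mono (AbelianVariety.hodgeGroup_le_specialLefschetzGroup A).1

/-- **`MT(A)(ℂ)|_{H¹} ≤ G(A)(ℂ)`** for every `h ∈ B¹(A) ⊗ ℂ` (the tree's
`mumfordTateGroup_apply_one_mem_similitudeCentralizerGroup`, as an inclusion of subgroups).
[cite: Milne1999LefschetzClasses, §4 pp. 659–660 (Thm. 4.4, `L(A) ⊃ Hg(A)`)] -/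
theorem mumfordTateGroup_map_one_le_similitudeCentralizerGroup (hh : h ∈ hodgeClassSpan A.dim A.X 1) :
    (mumfordTateGroup A.dim A.X).map
        (Pi.evalMonoidHom (fun k : ℕ ↦ complexBetti A.X k ≃ₗ[ℂ] complexBetti A.X k) 1) ≤
      similitudeCentralizerGroup A h := by
  rintro u ⟨m, hm, rfl⟩
  exact mumfordTateGroup_apply_one_mem_similitudeCentralizerGroup hh hm

end Literature.AlgebraicGeometry.Milne1999

end
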